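import Mathlib
import HarnessLib
import Literature.MathematicalPhysics.StatisticalMechanics.InitialActivityHamiltonianBundled
import Literature.MathematicalPhysics.StatisticalMechanics.InitialActivityPerturbationLipschitz

/-!
# `𝒦 ↦ y₀^{𝒦}` is Lipschitz into the scale-`0` activities: the hypothesis `hmp'` of
# `RGFlow.norm_initial_sub_le_of_isTunedQ` for the torus data ([ABKM19] Lemma 12.2, `j₁ = 1`)

Continuation of `InitialActivityHamiltonianBundled.lean` (`initAct 𝒦 : E_0 → F_0`, hypotheses `hy₀`,
`hm` of the fine-tuning engine) and `InitialActivityPerturbationLipschitz.lean`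
(`weakNormLE_initKH_sub_pert`).  The regular dependence of the tuned initial Hamiltonian `ℋ(𝒦)` on the
perturbation (`Literature/Dynamics/Hyperbolic/RGFlowStableManifoldSecondFixedPointLipschitz`,
hypothesis `hmp' : ∀ h, ‖h‖ ≤ ρ → Q 0 (y₀ h − y₀' h) m_p`) needs the bundled form of the `𝒦`-Lipschitz
estimate:

* **`activityNormLE_initAct_sub_pert`** — for `C^{r₀}` complex perturbations `𝒦, 𝒦'` with
  `‖D^s𝒦(z)‖, ‖D^s𝒦'(z)‖ ≤ ρe^{|z|²/4}` and `‖D^s(𝒦 − 𝒦')(z)‖ ≤ εe^{|z|²/4}`, `‖x‖ ≤ ⅛`, and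
  `e^{1/4}(ρ+ε)e^{𝔥_0}A ≤ ½`:
  `‖initAct 𝒦 x − initAct 𝒦' x‖_0^{(A)} ≤ e^{1/4}e^{𝔥_0}A · ε`.

Everything is proved; no named fact.

## References
* S. Adams, S. Buchholz, R. Kotecký, S. Müller, arXiv:1910.13564, Lemma 12.2 (12.9), Lemma 12.6,
  Theorem 2.2 [AdamsBuchholzKoteckyMuller2019].
-/

noncomputable section

namespace Literature.MathematicalPhysics.StatisticalMechanics.GradientRG

open scoped BigOperators Classical
open Finset Matrix
open Literature.MathematicalPhysics.QuantumFieldTheory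

variable {d M : ℕ} [NeZero M]

section Bundled

variable {L N Mord R n p r₀ : ℕ} {θbar lam μ δ₁ δ₀ A𝒫 h A : ℝ} {𝒞 : ℕ → (Fin d → ZMod M) → ℝ}

/-- **Hypothesis `hmp'` of `RGFlow.norm_initial_sub_le_of_isTunedQ` for the torus data**:
`‖y₀^{𝒦}(x) − y₀^{𝒦'}(x)‖_0^{(A)} ≤ e^{1/4}e^{𝔥_0}A·ε` for `‖x‖ ≤ ⅛`, when `‖D^s𝒦‖, ‖D^s𝒦'‖ ≤ ρe^{|z|²/4}`,
`‖D^s(𝒦−𝒦')‖ ≤ εe^{|z|²/4}` and `e^{1/4}(ρ+ε)e^{𝔥_0}A ≤ ½`.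
[cite: AdamsBuchholzKoteckyMuller2019, Lemma 12.2 (12.9) / Lemma 12.6] -/
theorem activityNormLE_initAct_sub_pert
    [∀ j : ℕ, Fact (0 < fieldWt h (L : ℝ) d j)] [∀ j : ℕ, Fact (0 < (L : ℝ) ^ j)] [∀ j : ℕ, Fact (0 < L ^ (d * j))]
    (hd : 2 ≤ d) (hLodd : Odd L) (hM : M = L ^ N)
    (hp : d / 2 + 1 ≤ p) (hMord : d / 2 + 1 ≤ Mord)
    (hB : AbkmWeightBounds L N Mord R n θbar lam μ δ₁ δ₀ A𝒫 𝒞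
      (abkmWeightData L N Mord R θbar (schedDelta δ₀ δ₁ N) 𝒞))
    (hδ₀ : 0 < δ₀) (hδ₁ : 0 < δ₁) (hh : 0 < h) (hh0 : hZeroSq d R δ₀ δ₁ ≤ h ^ 2) (hA : 0 < A)
    {𝒦 𝒦' : (Fin d → ℝ) → ℂ} {ρ ε : ℝ} (h𝒦 : ContDiff ℝ r₀ 𝒦) (h𝒦' : ContDiff ℝ r₀ 𝒦')
    (h𝒦b : ∀ k, k ≤ r₀ → ∀ z : Fin d → ℝ, ‖iteratedFDeriv ℝ k 𝒦 z‖ ≤ ρ * Real.exp ((∑ i, z i ^ 2) / 4))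
    (h𝒦'b : ∀ k, k ≤ r₀ → ∀ z : Fin d → ℝ, ‖iteratedFDeriv ℝ k 𝒦' z‖ ≤ ρ * Real.exp ((∑ i, z i ^ 2) / 4))
    (hΔb : ∀ k, k ≤ r₀ → ∀ z : Fin d → ℝ,
      ‖iteratedFDeriv ℝ k (fun z => 𝒦 z - 𝒦' z) z‖ ≤ ε * Real.exp ((∑ i, z i ^ 2) / 4))
    (hsmall : Real.exp (1 / 4) * ((ρ + ε) * Real.exp (fieldWt h (L : ℝ) d 0 / (L : ℝ) ^ 0)) * A ≤ 1 / 2)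
    (x : HamSpace ℂ d (fieldWt h (L : ℝ) d 0) ((L : ℝ) ^ 0) (L ^ (d * 0))) (hx : ‖x‖ ≤ 1 / 8) :
    activityNormLE (abkmNormParams L N Mord R p r₀ h θbar A (schedDelta δ₀ δ₁ N) 𝒞) 0
      (initAct (N := N) (Mord := Mord) (R := R) (p := p) (r₀ := r₀) (θbar := θbar) (A := A) (δ₀ := δ₀)
          (δ₁ := δ₁) (𝒞 := 𝒞) 𝒦 x -
        initAct (N := N) (Mord := Mord) (R := R) (p := p) (r₀ := r₀) (θbar := θbar) (A := A) (δ₀ := δ₀)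
          (δ₁ := δ₁) (𝒞 := 𝒞) 𝒦' x)
      (Real.exp (1 / 4) * Real.exp (fieldWt h (L : ℝ) d 0 / (L : ℝ) ^ 0) * A * ε) := by
  have hρ : 0 ≤ ρ := by
    have h0 := (norm_nonneg _).trans (h𝒦b 0 (Nat.zero_le _) 0)
    exact (mul_nonneg_iff_of_pos_right (Real.exp_pos _)).1 h0
  have hε : 0 ≤ ε := by
    have h0 := (norm_nonneg _).trans (hΔb 0 (Nat.zero_le _) 0)
    exact (mul_nonneg_iff_of_pos_right (Real.exp_pos _)).1 h0
  -- the smallness for membership: `e^{1/4}ρe^{𝔥₀}A ≤ 1`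
  have hsmall1 : Real.exp (1 / 4) * (ρ * Real.exp (fieldWt h (L : ℝ) d 0 / (L : ℝ) ^ 0)) * A ≤ 1 := by
    have h2 : Real.exp (1 / 4) * (ρ * Real.exp (fieldWt h (L : ℝ) d 0 / (L : ℝ) ^ 0)) * A ≤
        Real.exp (1 / 4) * ((ρ + ε) * Real.exp (fieldWt h (L : ℝ) d 0 / (L : ℝ) ^ 0)) * A :=
      mul_le_mul_of_nonneg_right (mul_le_mul_of_nonneg_left
        (mul_le_mul_of_nonneg_right (le_add_of_nonneg_right hε) (Real.exp_pos _).le) (Real.exp_pos _).le) hA.le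
    linarith
  have hH : hamNorm (fieldWt h (L : ℝ) d 0) ((L : ℝ) ^ 0) (L ^ (d * 0)) (HamSpace.toHam x) ≤ 1 / 8 := by
    rwa [HamSpace.norm_def] at hx
  have hmem := restrictConn_initKH_mem_activitySpace hd hLodd hM hp hMord hB hδ₀ hδ₁ hh hh0 hA h𝒦 h𝒦b hH hsmall1
  have hmem' := restrictConn_initKH_mem_activitySpace hd hLodd hM hp hMord hB hδ₀ hδ₁ hh hh0 hA h𝒦' h𝒦'b hH hsmall1
  unfold activityNormLE
  rw [Submodule.coe_sub, coe_initAct_of_mem hmem, coe_initAct_of_mem hmem', ← restrictConn_sub]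
  exact weakNormLE_restrictConn_iff.2
    (weakNormLE_initKH_sub_pert hd hLodd hM hp hMord hB hδ₀ hδ₁ hh hh0 hA h𝒦 h𝒦' h𝒦'b hΔb hH hsmall)

end Bundled

end Literature.MathematicalPhysics.StatisticalMechanics.GradientRG

end
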